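/-
Copyright (c) 2026 the pub-hodgecm-mathlib formalisation cell (harness21).  Prover seat hodgecm-mathlib-LH4-p14 (g3), req620 Track A «(D-RAM) FOUR-FRAME» squad
(unit U3_Laws, κ-STAGE B; brick «κ-BOX-SUM» (κ-B8 ∕ PART 2-κ) dealt by the dealer LH4-plan (g11) WORD #46 (1) ∕ #49 (1); κ owner LH4-p05 (g3); consumers: the (κ-B₀) payer of
F0P3a-p01 (g32) and this seat's (κS-B₀) assembler).  2026-09-04.
-/
import Summits.HodgeConjecture.HodgeConjecture.Theorems.F0P3cDyRamKappaCountBoxSumPlanes   -- FILE 2 (this seat): plane ∕ diagonal evaluations; brings FILE 1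
import Summits.HodgeConjecture.HodgeConjecture.Theorems.F0P3cDyRamKappaCountBoxSumTiling   -- FILE 3 (this seat): the tiling arithmetic
import Summits.HodgeConjecture.HodgeConjecture.Theorems.F0P3cDyRamStableCountBoxReindex    -- ★ B10 PART 2 FILE 1 (LH4-p14 (g2)): `sum_box_eq_triple_sum`, `triple_sum_eq_diag_add_planes`, `vec3_eq_iff`
import HarnessLib

/-!
# Crux `H413`, line LH4 «(D-RAM) FOUR-FRAME» road — unit U3_Laws (iii), κ-STAGE B, brick «κ-BOX-SUM» (κ-B8 ∕ PART 2-κ), FILE 4∕4 «THE IDENTITY»: `(q − 1)·Σ_{box} (κ-table) = SIGN·(q^k − q^{k−B})`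

Cell `hodgecm-mathlib` (D-0151), FLOOR 0, crux item H413 = `stmt-HodgeConjecture-24833`, route of record `HCCMUnconditional`; squad F0∕P3c∕LH4 (req618∕req620); registered stubs served:
the κ-Stage-B children (κ-B₀) `F0P3cDyRamFourFrameU3.stub_U3_kappaCount_typeZero` and (κS-B₀) `…stub_U3_kappaSignCount_typeZero` of `Cruxes/H413/Lines/F0_P3c_DyRamFourFrame_U3_Laws.lean`
ED. 10 (tree 4815bda2e7c89814), through the payers that feed THIS identity with the ★ κ-sockets.  THEOREMS ONLY (no `def`, no instance, no notation, no `sorry`, default heartbeats);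
lane `--supports stmt-HodgeConjecture-24833` (count-neutral).  Precedent and engine: ★ B10 PART 2 «BOX RE-INDEX» `F0P3cDyRamStableCountBoxReindex{,Planes,Types}` (LH4-p14 (g2)) and
★ B8 `F0P3cDyRamStableCountSum` — the unsigned (MS) analogue `(q−1)·Σ = q^k − 1`.

THE MATHEMATICS (LH4-p05 (g3) PLAN-KMS v1 §4; per-stratum letters: ★ p856661 T-sockets (LH4-p04 (g2)), κG-C2 G-socket (LH4-p09 (g3)), κH-B2 H-socket (LH4-p06∕p08 (g3)); this
seat's numerics `kappa_sum_tv0.v1` f242ecc3 ∕ `kappa_boxsum_leanshape.v1` 40f1a7eb, 1995∕1995 rows).  Fix a slot `i`.  The κ-weighted class count of the type-0 vertex lattices,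
written stratum by stratum over the axis box, is a table with SIGN PARAMETERS: on-branch `T_p(s)`: `[i = p][2d ≤ s][2∣s][s ≤ n_p]·ω q^{s∕2}`; glued `G_p(ρ,s)`: TUBE
`[i = p]·ω q^{2ρ+s∕2−1}((q−1)[2d ≤ s] − [s+2 = 2d])` + GLUE SHELL at the apex foot (`n_legs = m < n_p = m+s`, `m < 2ρ ≤ 2m−d+1`) `ε·q^{2ρ+s∕2−c}`, `c = ⌈(2ρ−m)∕2⌉`, alive iff
`2d ≤ s + 2c` (foot slot) resp. `d ≤ c` (cross slots); core-hanging `H(ρ)` (equilateral key only): `[d ≤ c]·εH·q^{2ρ−c}`; the core and the wild tubes' stable mass are DEAD.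
THE IDENTITY: `(q − 1)·Σ_{box} = SIGN·(q^k − q^{k−B})`, `2k + d = Σn + 2`, `2B = n_i + 2(d%2) + 2 − 3d` (`B ≤ 0` ⇒ `0`), `SIGN = εH` (equilateral) ∕ the apex foot's glue entry at
slot `i`.  MECHANISM: in the slot's own (foot) plane the on-branch block `Σ_{d ≤ j ≤ ⌊n∕2⌋} q^j` is EXTENDED by the deep tubes and EATEN from below by the boundary tubes
(`s + 2 = 2d`), telescoping to `ω·q^{[2⌊m∕2⌋+d, ⌊n∕2⌋+⌊m∕2⌋]}` when the apex excess is `≥ 2d` and to `0` otherwise; the alive glue cells are the consecutive powers above, up to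
`q^{k−1}`; the two pieces tile `[k−B, k−1]` with ONE sign because «excess ≥ 2d ⇒ foot glue sign = ω» (the conductor side condition, a hypothesis here, discharged by the assemblers
with ★ `normSign_eq_one_of_fixed_of_v_sub_one_le`).  `2 ≤ d` is NEEDED (at `d = 1` the tame tube survives and the identity is false — 462 numeric counterexamples).

CONTENTS (FILE 4∕4 «THE IDENTITY»).
* `sum_box_kappa_eq_typeZero` — HEAD, the statement frozen in the (κS-B₀) skeleton `KSB0-KappaSignCountTypeZero.SKELETON.v1` 9ee9a0d6 (binder `hbox`) and consumed VERBATIM by the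
  (κ-B₀) payer `F0P3cDyRamKappaCountTypeZero.kappaCount_typeZero_of_boxSum` (F0P3a-p01 (g32), cand v3 32407b59): the table hypotheses are the ★ socket heads with the field
  signs replaced by the parameters `ω` (`= normSign σ (−1)`), `εG p j` (glue entries), `εH`; over ★ PART 2 §1–§2 (`sum_box_eq_triple_sum`, `triple_sum_eq_diag_add_planes`),
  FILE 2's plane∕diagonal evaluations and FILE 3's tiling.
HONEST LABEL.  Count-neutral (`--supports stmt-HodgeConjecture-24833`); finite-sum bookkeeping over `ℚ`, nothing printed is asserted, no lattice enters; the κ-Stage-B children (κ-B₀)∕(κS-B₀) of U3 ED. 10 stay PROVER TARGETS until their payers land; `HC_CM` is proved only modulo the 7 printed citations (2 remaining named inputs: hLiu418 = `stmt-HodgeConjecture-24832`, h413 = `stmt-HodgeConjecture-24833`) until rung 0 closes.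

## References
* [Kottwitz1986BaseChangeUnits] R. E. Kottwitz, *Base change for unit elements of Hecke algebras*, Compositio Math. 60 (1986), §1 pp. 240–241 (κ-orbital integrals of units as signed lattice counts by position).
* [Rogawski1990] J. D. Rogawski, *Automorphic Representations of Unitary Groups in Three Variables*, Ann. of Math. Stud. 123 (1990), §4.9 Prop. 4.9.1 (a) p. 55, §4.10 p. 58 (the κ-signs on the classes inside a stable class).
-/

set_option autoImplicit false

namespace Summit.HodgeConjecture.HodgeConjecture.Cruxes.H413.F0P3cDyRamKappaCountBoxSum

open Finset
open Summit.HodgeConjecture.HodgeConjecture.Cruxes.H413.F0P3cDyRamStableCountBoxReindex (vec3_eq_iff sum_box_eq_triple_sum triple_sum_eq_diag_add_planes)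
open Summit.HodgeConjecture.HodgeConjecture.Cruxes.H413.F0P3cDyRamKappaCountBoxSumPlanes
open Summit.HodgeConjecture.HodgeConjecture.Cruxes.H413.F0P3cDyRamKappaCountBoxSumTiling

section Box

/-- **«κ-BOX-SUM» (κ-B8 ∕ PART 2-κ), TYPE 0.**  Let `v : (Fin 3 → ℕ) → ℚ` follow the type-0 κ-TABLE of slot `i` with SIGN PARAMETERS — on-branch `T_p(s)`: `[i = p][2d ≤ s][2∣s][s ≤ n_p]·ω q^{s/2}`;
glued `G_p(ρ,s)`: TUBE `[i = p]·ω q^{2ρ+s/2−1}((q−1)[2d ≤ s] − [s+2 = 2d])` + GLUE SHELL `(εG p j bracketed: foot [2d ≤ s + 2⌈(2ρ−m)/2⌉], cross [d ≤ ⌈(2ρ−m)/2⌉])_i · q^{2ρ+s/2−⌈(2ρ−m)/2⌉}`;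
core-hanging `H(ρ)`: the equilateral glue `[d ≤ ⌈(2ρ−m)/2⌉]·εH·q^{2ρ−⌈(2ρ−m)/2⌉}` (tube part dead); core dead; zero off the type-0 shape list — for an ISOCELES key `(n₁,n₂,n₃)`,
`nⱼ ≡ d (mod 2)`, `2 ≤ d ≤ min nⱼ`, `Σnⱼ ≤ Bx`, `2k + d = Σnⱼ + 2`, with the CONDUCTOR SIDE CONDITION «apex excess ≥ 2d ⇒ the foot glue sign IS ω».  Then
`(q − 1)·Σ_{a ∈ box} v a = SIGN·(q^k − q^{k − B})`, `SIGN = εH` (equilateral) ∕ `εG ‹apex› i`, `B = (n_i + 2(d%2) + 2 − 3d)⁺/2` (`B = 0` ⇒ `0`): the on-branch block and the deep tubes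
telescope, the boundary tubes eat them from below, and the alive glue cells tile `[k − B, k − 1]` with one sign.  Pure finite-sum bookkeeping over `ℚ` (no lattices); the
(κ-B₀)∕(κS-B₀) assemblers feed it the squad's ★ κ-sockets (T p856661, G κG-C2, H κH-B2) with `ω = normSign σ (−1)`, `εG`∕`εH` the sockets' glue signs.
[cite: Kottwitz1986BaseChangeUnits, §1 pp. 240–241] [cite: Rogawski1990, §4.9 Prop. 4.9.1 (a) p. 55] -/
theorem sum_box_kappa_eq_typeZero (q : ℕ) {d n₁ n₂ n₃ Bx k : ℕ} (hd : 2 ≤ d)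
    (hiso : (n₁ = n₂ ∧ n₁ ≤ n₃) ∨ (n₁ = n₃ ∧ n₁ ≤ n₂) ∨ (n₂ = n₃ ∧ n₂ ≤ n₁))
    (hdn : d ≤ min n₁ (min n₂ n₃)) (h1 : n₁ % 2 = d % 2) (h2 : n₂ % 2 = d % 2) (h3 : n₃ % 2 = d % 2) (hBx : n₁ + n₂ + n₃ ≤ Bx)
    (hk : 2 * k + d = n₁ + n₂ + n₃ + 2) (i : Fin 3) (ω εH : ℚ) (εG : Fin 3 → Fin 3 → ℚ)
    (hω0 : i = 0 → n₂ = n₃ → n₂ + 2 * d ≤ n₁ → εG 0 0 = ω) (hω1 : i = 1 → n₁ = n₃ → n₁ + 2 * d ≤ n₂ → εG 1 1 = ω)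
    (hω2 : i = 2 → n₁ = n₂ → n₁ + 2 * d ≤ n₃ → εG 2 2 = ω)
    (v : (Fin 3 → ℕ) → ℚ) (hcore : v ![0, 0, 0] = 0)
    (hT1 : ∀ s, 1 ≤ s → v ![0, s, s] = if i = 0 ∧ 2 * d ≤ s ∧ 2 ∣ s ∧ s ≤ n₁ then ω * (q : ℚ) ^ (s / 2) else 0)
    (hT2 : ∀ s, 1 ≤ s → v ![s, 0, s] = if i = 1 ∧ 2 * d ≤ s ∧ 2 ∣ s ∧ s ≤ n₂ then ω * (q : ℚ) ^ (s / 2) else 0)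
    (hT3 : ∀ s, 1 ≤ s → v ![s, s, 0] = if i = 2 ∧ 2 * d ≤ s ∧ 2 ∣ s ∧ s ≤ n₃ then ω * (q : ℚ) ^ (s / 2) else 0)
    (hG1 : ∀ ρ s, 1 ≤ ρ → 1 ≤ s → v ![2 * ρ, 2 * ρ + s, 2 * ρ + s] =
      (if 2 ∣ s ∧ 2 * ρ ≤ min n₂ n₃ ∧ 2 * ρ + s ≤ n₁ then
          (![ω * (q : ℚ) ^ (2 * ρ + s / 2 - 1) * ((if 2 * d ≤ s then (q : ℚ) - 1 else 0) - (if s + 2 = 2 * d then 1 else 0)), 0, 0] : Fin 3 → ℚ) i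
        else 0) +
      (if 2 ∣ s ∧ n₂ = n₃ ∧ n₁ = n₂ + s ∧ n₂ < 2 * ρ ∧ 2 * ρ - n₂ ≤ n₂ - d + 1 then
          (![if 2 * d ≤ s + 2 * ((2 * ρ - n₂ + 1) / 2) then εG 0 0 else 0,
             if d ≤ (2 * ρ - n₂ + 1) / 2 then εG 0 1 else 0,
             if d ≤ (2 * ρ - n₂ + 1) / 2 then εG 0 2 else 0] : Fin 3 → ℚ) i * (q : ℚ) ^ (2 * ρ + s / 2 - (2 * ρ - n₂ + 1) / 2)
        else 0))
    (hG2 : ∀ ρ s, 1 ≤ ρ → 1 ≤ s → v ![2 * ρ + s, 2 * ρ, 2 * ρ + s] =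
      (if 2 ∣ s ∧ 2 * ρ ≤ min n₁ n₃ ∧ 2 * ρ + s ≤ n₂ then
          (![0, ω * (q : ℚ) ^ (2 * ρ + s / 2 - 1) * ((if 2 * d ≤ s then (q : ℚ) - 1 else 0) - (if s + 2 = 2 * d then 1 else 0)), 0] : Fin 3 → ℚ) i
        else 0) +
      (if 2 ∣ s ∧ n₁ = n₃ ∧ n₂ = n₁ + s ∧ n₁ < 2 * ρ ∧ 2 * ρ - n₁ ≤ n₁ - d + 1 then
          (![if d ≤ (2 * ρ - n₁ + 1) / 2 then εG 1 0 else 0,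
             if 2 * d ≤ s + 2 * ((2 * ρ - n₁ + 1) / 2) then εG 1 1 else 0,
             if d ≤ (2 * ρ - n₁ + 1) / 2 then εG 1 2 else 0] : Fin 3 → ℚ) i * (q : ℚ) ^ (2 * ρ + s / 2 - (2 * ρ - n₁ + 1) / 2)
        else 0))
    (hG3 : ∀ ρ s, 1 ≤ ρ → 1 ≤ s → v ![2 * ρ + s, 2 * ρ + s, 2 * ρ] =
      (if 2 ∣ s ∧ 2 * ρ ≤ min n₁ n₂ ∧ 2 * ρ + s ≤ n₃ then
          (![0, 0, ω * (q : ℚ) ^ (2 * ρ + s / 2 - 1) * ((if 2 * d ≤ s then (q : ℚ) - 1 else 0) - (if s + 2 = 2 * d then 1 else 0))] : Fin 3 → ℚ) i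
        else 0) +
      (if 2 ∣ s ∧ n₁ = n₂ ∧ n₃ = n₁ + s ∧ n₁ < 2 * ρ ∧ 2 * ρ - n₁ ≤ n₁ - d + 1 then
          (![if d ≤ (2 * ρ - n₁ + 1) / 2 then εG 2 0 else 0,
             if d ≤ (2 * ρ - n₁ + 1) / 2 then εG 2 1 else 0,
             if 2 * d ≤ s + 2 * ((2 * ρ - n₁ + 1) / 2) then εG 2 2 else 0] : Fin 3 → ℚ) i * (q : ℚ) ^ (2 * ρ + s / 2 - (2 * ρ - n₁ + 1) / 2)
        else 0))
    (hH : ∀ ρ, 1 ≤ ρ → v ![2 * ρ, 2 * ρ, 2 * ρ] =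
      if n₁ = n₂ ∧ n₂ = n₃ ∧ n₁ < 2 * ρ ∧ 2 * ρ - n₁ ≤ n₁ - d + 1 ∧ d ≤ (2 * ρ - n₁ + 1) / 2 then εH * (q : ℚ) ^ (2 * ρ - (2 * ρ - n₁ + 1) / 2) else 0)
    (hzero : ∀ a : Fin 3 → ℕ, ¬ ((a = ![0, 0, 0]) ∨
      (∃ s, 2 ∣ s ∧ 2 ≤ s ∧ (a = ![0, s, s] ∨ a = ![s, 0, s] ∨ a = ![s, s, 0])) ∨
      (∃ ρ s, 1 ≤ ρ ∧ 2 ∣ s ∧ 2 ≤ s ∧ (a = ![2 * ρ, 2 * ρ + s, 2 * ρ + s] ∨ a = ![2 * ρ + s, 2 * ρ, 2 * ρ + s] ∨ a = ![2 * ρ + s, 2 * ρ + s, 2 * ρ])) ∨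
      (∃ ρ, 1 ≤ ρ ∧ a = ![2 * ρ, 2 * ρ, 2 * ρ])) → v a = 0) :
    ((q : ℚ) - 1) * ∑ a : Fin 3 → Fin (Bx + 1), v (fun j => (a j : ℕ)) =
      (if n₁ = n₂ ∧ n₂ = n₃ then εH else if n₂ = n₃ then εG 0 i else if n₁ = n₃ then εG 1 i else εG 2 i) *
        ((q : ℚ) ^ k - (q : ℚ) ^ (k - ((![n₁, n₂, n₃] : Fin 3 → ℕ) i + 2 * (d % 2) + 2 - 3 * d) / 2)) := by
  have hd1 : 1 ≤ d := by omega
  -- (0) the odd-parity cells are off the shape list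
  have hzT1 : ∀ s, 1 ≤ s → ¬ 2 ∣ s → v ![0, s, s] = 0 := fun s hs hs2 => hzero _ (by
    rintro (h | ⟨s', hs', -, h | h | h⟩ | ⟨ρ, s', hρ, hs', -, h | h | h⟩ | ⟨ρ, hρ, h⟩) <;> rw [vec3_eq_iff] at h <;> omega)
  have hz_diag : ∀ r, 1 ≤ r → ¬ 2 ∣ r → v ![r, r, r] = 0 := fun r hr hr2 => hzero _ (by
    rintro (h | ⟨s', hs', -, h | h | h⟩ | ⟨ρ, s', hρ, hs', -, h | h | h⟩ | ⟨ρ, hρ, h⟩) <;> rw [vec3_eq_iff] at h <;> omega)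
  have hz_p1 : ∀ r s, 1 ≤ r → ¬ 2 ∣ r → 1 ≤ s → v ![r, r + s, r + s] = 0 := fun r s hr hr2 hs => hzero _ (by
    rintro (h | ⟨s', hs', -, h | h | h⟩ | ⟨ρ, s', hρ, hs', -, h | h | h⟩ | ⟨ρ, hρ, h⟩) <;> rw [vec3_eq_iff] at h <;> omega)
  have hz_p2 : ∀ r s, 1 ≤ r → ¬ 2 ∣ r → 1 ≤ s → v ![r + s, r, r + s] = 0 := fun r s hr hr2 hs => hzero _ (by
    rintro (h | ⟨s', hs', -, h | h | h⟩ | ⟨ρ, s', hρ, hs', -, h | h | h⟩ | ⟨ρ, hρ, h⟩) <;> rw [vec3_eq_iff] at h <;> omega)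
  have hz_p3 : ∀ r s, 1 ≤ r → ¬ 2 ∣ r → 1 ≤ s → v ![r + s, r + s, r] = 0 := fun r s hr hr2 hs => hzero _ (by
    rintro (h | ⟨s', hs', -, h | h | h⟩ | ⟨ρ, s', hρ, hs', -, h | h | h⟩ | ⟨ρ, hρ, h⟩) <;> rw [vec3_eq_iff] at h <;> omega)
  have hreg : ∀ x y z : ℕ, v ![x, y, z] ≠ 0 → (x = y ∧ y = z) ∨ (y = z ∧ x < y) ∨ (x = z ∧ y < x) ∨ (x = y ∧ z < x) := by
    intro x y z hne
    by_contra hc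
    refine hne (hzero _ ?_)
    rintro (h | ⟨s', hs', hs2, h | h | h⟩ | ⟨ρ, s', hρ, hs', hs2, h | h | h⟩ | ⟨ρ, hρ, h⟩) <;> rw [vec3_eq_iff] at h <;> omega
  clear hzT1
  have hm₁ : min n₁ (min n₂ n₃) ≤ n₁ := min_le_left _ _
  have hm₂ : min n₁ (min n₂ n₃) ≤ n₂ := le_trans (min_le_right _ _) (min_le_left _ _)
  have hm₃ : min n₁ (min n₂ n₃) ≤ n₃ := le_trans (min_le_right _ _) (min_le_right _ _)
  -- (1) the planes' glued rows in the generic shape (slot bookkeeping)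
  have hG1' : ∀ ρ s, 1 ≤ ρ → 1 ≤ s → (fun r t => v ![r, t, t]) (2 * ρ) (2 * ρ + s) =
      (if (i = 0) ∧ 2 ∣ s ∧ 2 * ρ ≤ min n₂ n₃ ∧ 2 * ρ + s ≤ n₁ then
          ω * (q : ℚ) ^ (2 * ρ + s / 2 - 1) * ((if 2 * d ≤ s then (q : ℚ) - 1 else 0) - (if s + 2 = 2 * d then 1 else 0)) else 0) +
      (if 2 ∣ s ∧ n₂ = n₃ ∧ n₁ = n₂ + s ∧ n₂ < 2 * ρ ∧ 2 * ρ - n₂ ≤ n₂ - d + 1 then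
          (if (fun s c => (i = 0 → 2 * d ≤ s + 2 * c) ∧ (i ≠ 0 → d ≤ c)) s ((2 * ρ - n₂ + 1) / 2) then εG 0 i else 0) *
            (q : ℚ) ^ (2 * ρ + s / 2 - (2 * ρ - n₂ + 1) / 2) else 0) := by
    intro ρ s hρ hs
    simp only []
    rw [hG1 ρ s hρ hs, (vec_single_ite _ _ i).1, (vec_bracket_ite _ _ (εG 0) i).1]
  have hG2' : ∀ ρ s, 1 ≤ ρ → 1 ≤ s → (fun r t => v ![t, r, t]) (2 * ρ) (2 * ρ + s) =
      (if (i = 1) ∧ 2 ∣ s ∧ 2 * ρ ≤ min n₁ n₃ ∧ 2 * ρ + s ≤ n₂ then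
          ω * (q : ℚ) ^ (2 * ρ + s / 2 - 1) * ((if 2 * d ≤ s then (q : ℚ) - 1 else 0) - (if s + 2 = 2 * d then 1 else 0)) else 0) +
      (if 2 ∣ s ∧ n₁ = n₃ ∧ n₂ = n₁ + s ∧ n₁ < 2 * ρ ∧ 2 * ρ - n₁ ≤ n₁ - d + 1 then
          (if (fun s c => (i = 1 → 2 * d ≤ s + 2 * c) ∧ (i ≠ 1 → d ≤ c)) s ((2 * ρ - n₁ + 1) / 2) then εG 1 i else 0) *
            (q : ℚ) ^ (2 * ρ + s / 2 - (2 * ρ - n₁ + 1) / 2) else 0) := by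
    intro ρ s hρ hs
    simp only []
    rw [hG2 ρ s hρ hs, (vec_single_ite _ _ i).2.1, (vec_bracket_ite _ _ (εG 1) i).2.1]
  have hG3' : ∀ ρ s, 1 ≤ ρ → 1 ≤ s → (fun r t => v ![t, t, r]) (2 * ρ) (2 * ρ + s) =
      (if (i = 2) ∧ 2 ∣ s ∧ 2 * ρ ≤ min n₁ n₂ ∧ 2 * ρ + s ≤ n₃ then
          ω * (q : ℚ) ^ (2 * ρ + s / 2 - 1) * ((if 2 * d ≤ s then (q : ℚ) - 1 else 0) - (if s + 2 = 2 * d then 1 else 0)) else 0) +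
      (if 2 ∣ s ∧ n₁ = n₂ ∧ n₃ = n₁ + s ∧ n₁ < 2 * ρ ∧ 2 * ρ - n₁ ≤ n₁ - d + 1 then
          (if (fun s c => (i = 2 → 2 * d ≤ s + 2 * c) ∧ (i ≠ 2 → d ≤ c)) s ((2 * ρ - n₁ + 1) / 2) then εG 2 i else 0) *
            (q : ℚ) ^ (2 * ρ + s / 2 - (2 * ρ - n₁ + 1) / 2) else 0) := by
    intro ρ s hρ hs
    simp only []
    rw [hG3 ρ s hρ hs, (vec_single_ite _ _ i).2.2, (vec_bracket_ite _ _ (εG 2) i).2.2]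
  -- (2) diagonal + planes, evaluated
  rw [sum_box_eq_triple_sum, triple_sum_eq_diag_add_planes Bx v hreg,
    kappa_diag_sum (q : ℚ) εH (n₁ = n₂) (n₂ = n₃) (le_trans hdn hm₁) h1 (fun h12 h23 => by omega) (fun r => v ![r, r, r]) hcore hH hz_diag,
    kappa_plane_sum (q : ℚ) ω (εG 0 i) (i = 0) (fun s c => (i = 0 → 2 * d ≤ s + 2 * c) ∧ (i ≠ 0 → d ≤ c)) hd (le_trans hdn hm₂)
      (fun _ => h2) (by omega) (fun r t => v ![r, t, t]) hT1 hG1' hz_p1,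
    kappa_plane_sum (q : ℚ) ω (εG 1 i) (i = 1) (fun s c => (i = 1 → 2 * d ≤ s + 2 * c) ∧ (i ≠ 1 → d ≤ c)) hd (le_trans hdn hm₁)
      (fun _ => h1) (by omega) (fun r t => v ![t, r, t]) hT2 hG2' hz_p2,
    kappa_plane_sum (q : ℚ) ω (εG 2 i) (i = 2) (fun s c => (i = 2 → 2 * d ≤ s + 2 * c) ∧ (i ≠ 2 → d ≤ c)) hd (le_trans hdn hm₁)
      (fun _ => h1) (by omega) (fun r t => v ![t, t, r]) hT3 hG3' hz_p3]
  -- (3) evaluate every block times `q − 1`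
  have hbrk : ∀ (p : Fin 3) (s c : ℕ), ((i = p → 2 * d ≤ s + 2 * c) ∧ (i ≠ p → d ≤ c)) ↔ (if i = p then d - s / 2 else d) ≤ c := by
    intro p s c
    by_cases hip : i = p
    · rw [if_pos hip]; constructor
      · rintro ⟨h, -⟩; have := h hip; omega
      · intro h; exact ⟨fun _ => by omega, fun h' => absurd hip h'⟩
    · rw [if_neg hip]; constructor
      · rintro ⟨-, h⟩; exact h hip
      · intro h; exact ⟨fun h' => absurd h' hip, fun _ => h⟩
  have eF0 : ((q : ℚ) - 1) * (ω * ∑ j ∈ Icc d (n₁ / 2), (q : ℚ) ^ j) + ((q : ℚ) - 1) * (ω * ∑ ρ ∈ Icc 1 (min n₂ n₃ / 2),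
      ((if ρ + d ≤ n₁ / 2 then (q : ℚ) ^ (n₁ / 2 + ρ) - (q : ℚ) ^ (2 * ρ + d - 1) else 0) - (if ρ + d ≤ n₁ / 2 + 1 then (q : ℚ) ^ (2 * ρ + d - 2) else 0)))
      = if min n₂ n₃ / 2 + d ≤ n₁ / 2 then ω * ((q : ℚ) ^ (n₁ / 2 + min n₂ n₃ / 2 + 1) - (q : ℚ) ^ (2 * (min n₂ n₃ / 2) + d)) else 0 := by
    rw [← mul_add, ← mul_add]; exact foot_mul_eval (q : ℚ) ω hd1 _ _
  have eF1 : ((q : ℚ) - 1) * (ω * ∑ j ∈ Icc d (n₂ / 2), (q : ℚ) ^ j) + ((q : ℚ) - 1) * (ω * ∑ ρ ∈ Icc 1 (min n₁ n₃ / 2),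
      ((if ρ + d ≤ n₂ / 2 then (q : ℚ) ^ (n₂ / 2 + ρ) - (q : ℚ) ^ (2 * ρ + d - 1) else 0) - (if ρ + d ≤ n₂ / 2 + 1 then (q : ℚ) ^ (2 * ρ + d - 2) else 0)))
      = if min n₁ n₃ / 2 + d ≤ n₂ / 2 then ω * ((q : ℚ) ^ (n₂ / 2 + min n₁ n₃ / 2 + 1) - (q : ℚ) ^ (2 * (min n₁ n₃ / 2) + d)) else 0 := by
    rw [← mul_add, ← mul_add]; exact foot_mul_eval (q : ℚ) ω hd1 _ _
  have eF2 : ((q : ℚ) - 1) * (ω * ∑ j ∈ Icc d (n₃ / 2), (q : ℚ) ^ j) + ((q : ℚ) - 1) * (ω * ∑ ρ ∈ Icc 1 (min n₁ n₂ / 2),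
      ((if ρ + d ≤ n₃ / 2 then (q : ℚ) ^ (n₃ / 2 + ρ) - (q : ℚ) ^ (2 * ρ + d - 1) else 0) - (if ρ + d ≤ n₃ / 2 + 1 then (q : ℚ) ^ (2 * ρ + d - 2) else 0)))
      = if min n₁ n₂ / 2 + d ≤ n₃ / 2 then ω * ((q : ℚ) ^ (n₃ / 2 + min n₁ n₂ / 2 + 1) - (q : ℚ) ^ (2 * (min n₁ n₂ / 2) + d)) else 0 := by
    rw [← mul_add, ← mul_add]; exact foot_mul_eval (q : ℚ) ω hd1 _ _
  have eD : ((q : ℚ) - 1) * (εH * ∑ c ∈ Icc 1 ((n₁ - d) / 2 + d % 2), (if d ≤ c then (q : ℚ) ^ (2 * (n₁ / 2) + c) else 0))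
      = εH * (if max 1 d ≤ (n₁ - d) / 2 + d % 2 then (q : ℚ) ^ (2 * (n₁ / 2) + ((n₁ - d) / 2 + d % 2) + 1) - (q : ℚ) ^ (2 * (n₁ / 2) + max 1 d) else 0) := by
    rw [mul_left_comm, window_mul_eval]
  have eW0 : ((q : ℚ) - 1) * (εG 0 i * ∑ c ∈ Icc 1 ((n₂ - d) / 2 + d % 2),
        (if (i = 0 → 2 * d ≤ n₁ - n₂ + 2 * c) ∧ (i ≠ 0 → d ≤ c) then (q : ℚ) ^ (2 * (n₂ / 2) + (n₁ - n₂) / 2 + c) else 0))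
      = εG 0 i * (if max 1 (if i = 0 then d - (n₁ - n₂) / 2 else d) ≤ (n₂ - d) / 2 + d % 2 then
          (q : ℚ) ^ (2 * (n₂ / 2) + (n₁ - n₂) / 2 + ((n₂ - d) / 2 + d % 2) + 1) - (q : ℚ) ^ (2 * (n₂ / 2) + (n₁ - n₂) / 2 + max 1 (if i = 0 then d - (n₁ - n₂) / 2 else d)) else 0) := by
    rw [mul_left_comm, window_mul_eval' (q : ℚ) _ _ _ _ (hbrk 0 (n₁ - n₂))]
  have eW1 : ((q : ℚ) - 1) * (εG 1 i * ∑ c ∈ Icc 1 ((n₁ - d) / 2 + d % 2),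
        (if (i = 1 → 2 * d ≤ n₂ - n₁ + 2 * c) ∧ (i ≠ 1 → d ≤ c) then (q : ℚ) ^ (2 * (n₁ / 2) + (n₂ - n₁) / 2 + c) else 0))
      = εG 1 i * (if max 1 (if i = 1 then d - (n₂ - n₁) / 2 else d) ≤ (n₁ - d) / 2 + d % 2 then
          (q : ℚ) ^ (2 * (n₁ / 2) + (n₂ - n₁) / 2 + ((n₁ - d) / 2 + d % 2) + 1) - (q : ℚ) ^ (2 * (n₁ / 2) + (n₂ - n₁) / 2 + max 1 (if i = 1 then d - (n₂ - n₁) / 2 else d)) else 0) := by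
    rw [mul_left_comm, window_mul_eval' (q : ℚ) _ _ _ _ (hbrk 1 (n₂ - n₁))]
  have eW2 : ((q : ℚ) - 1) * (εG 2 i * ∑ c ∈ Icc 1 ((n₁ - d) / 2 + d % 2),
        (if (i = 2 → 2 * d ≤ n₃ - n₁ + 2 * c) ∧ (i ≠ 2 → d ≤ c) then (q : ℚ) ^ (2 * (n₁ / 2) + (n₃ - n₁) / 2 + c) else 0))
      = εG 2 i * (if max 1 (if i = 2 then d - (n₃ - n₁) / 2 else d) ≤ (n₁ - d) / 2 + d % 2 then
          (q : ℚ) ^ (2 * (n₁ / 2) + (n₃ - n₁) / 2 + ((n₁ - d) / 2 + d % 2) + 1) - (q : ℚ) ^ (2 * (n₁ / 2) + (n₃ - n₁) / 2 + max 1 (if i = 2 then d - (n₃ - n₁) / 2 else d)) else 0) := by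
    rw [mul_left_comm, window_mul_eval' (q : ℚ) _ _ _ _ (hbrk 2 (n₃ - n₁))]
  simp only [mul_add, mul_ite, mul_zero]
  rw [eF0, eF1, eF2, eD, eW0, eW1, eW2]
  clear eF0 eF1 eF2 eD eW0 eW1 eW2 hG1' hG2' hG3' hG1 hG2 hG3 hT1 hT2 hT3 hH hzero hreg hz_diag hz_p1 hz_p2 hz_p3 hcore hbrk
  exact kappa_arith (q : ℚ) ω εH εG hd hiso hdn h1 h2 h3 hk i hω0 hω1 hω2

end Box

end Summit.HodgeConjecture.HodgeConjecture.Cruxes.H413.F0P3cDyRamKappaCountBoxSum
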